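import Literature.Analysis.FluidPDE.SereginZajaczkowski2007SwirlEnergyIdentity
import Literature.Analysis.FluidPDE.SereginZajaczkowski2007SwirlGronwall
import Literature.Analysis.FluidPDE.SereginSverakOffAxisLeaves
import HarnessLib

/-!
# Seregin–Zajaczkowski 2007, proof of Lemma 4.3: the estimates of `J₁`, `J₂` and the main inequality

G. Seregin, W. Zajaczkowski, *A sufficient condition of regularity for axially symmetric
solutions to the Navier–Stokes equations*, SIAM J. Math. Anal. 39 (2007) 669–685 =
arXiv:math/0702720, §4, proof of Lemma 4.3 (arXiv p. 6). After the identity (4.16) (proved in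
`SereginZajaczkowski2007SwirlEnergyIdentity.lean`), the printed proof estimates
`J₁ = ∫ α α̃|α̃|² (V_ϱψ_{,ϱ} + V₃ψ_{,3})` and `J₂` "by Hölder's inequality and by multiplicative
inequality (4.17)", with `𝒜₃ = ‖V^a‖_{L_{4,∞}(Q̃₁)}` supplied by Lemma 4.2, and concludes: "making use
of Young's inequality, we derive from (4.17) and from two latter estimates the main inequality
`∂ₜ∫_{𝒞̃₁}|α̃|⁴ + ∫_{𝒞̃₁}|∇_a(|α̃|²)|² ≤ c∫|β̃|²(∫|∇V|² + 𝒜₂) + c(𝒜₂𝒜₃⁵)^{4/11} + c(∫|∇V|² + 𝒜₂)^{4/11}`".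

This proofs-only file PROVES that main inequality at every fixed time `-(7/4)² < t < 0`, for the
class of Prop. 4.1 (`IsSmoothAxisymmetricSolutionOn Q̃ V P`, `𝒜₂ ≤ K`) and every cut-off of the
printed kind, in the kernel form consumed by the Grönwall step
(`swirlL4EnergyBound_of_energyInequality`, `SereginZajaczkowski2007SwirlGronwall.lean`):

* `ofReal_integral_l4Density_add_le`:
  `ofReal (∫ ∂ₜ(α̃⁴) dx + ∫ ‖∇ₓβ̃‖² dx) ≤ A(K) (1 + ∫_𝒞̃|∇V(·,t)|² dx)(1 + ∫ β̃² dx)` in `ℝ≥0∞`,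
  with the explicit monotone constant `A(K) = l4KernelConst M K = 1 + Φ₁(20, K)
  + 12000(M+1)²(c+1)(1+K)` (`M` the slab bound of the cut-off data, `c` the constant of (4.17),
  `Φ₁` the function of Lemma 4.2 chosen once from the discharged `OffAxisPoloidalBound_holds`,
  `poloidalPhi`).

The bookkeeping deviates from the printed exponents only in inessential ways, all weaker demands
on the inputs: Lemma 4.2 is used at `q = 20` instead of `q = 4` (the tree's Lemma 4.2 gives every
`q`), which replaces the Gagliardo–Nirenberg step for `α` by the pointwise `b³v² ≤ b^{10/3} + v²⁰`;
Hölder is replaced by pointwise Young inequalities with a time-dependent parameter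
(`young_J₁`, `young_J₂`: `|f|³|α||V^a| ≤ (9l/2)‖V‖² + (β̃^{10/3} + |V^a|²⁰)/(2l)`,
`|f|³(|α| + ‖∇α‖) ≤ m(11‖V‖² + 18|∇V|²) + (β̃² + β̃^{10/3})/(2m)`, using `|α| ≤ 3‖V‖`,
`‖∇α‖ ≤ 3‖∇V‖ + ‖V‖` on `𝒞̃`); (4.17) enters as `∫β̃^{10/3} ≤ c(1 + Y)D`
(`integral_betaTilde_rpow_le`, from the accepted `setLIntegral_betaTilde_rpow_le` and
`Y^{2/3} ≤ 1 + Y`); the choice `m = 18(M+1)(c+1)(1+Y)`, `l = 2(M+1)(c+1)(1+Y)` absorbs the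
`β̃^{10/3}`-terms into the dissipation (`l4_energy_arith`, pure real arithmetic). The transport term
involves only `V^a` because `Dψ[Jx] = 0` (`abs_l4Remainder_le` of the identity file).

No Props are defined; `poloidalPhi`, `l4KernelConst` are `ℝ≥0`-valued helpers; no named facts.

## References

* G. Seregin, W. Zajaczkowski, SIAM J. Math. Anal. 39 (2007) 669–685, arXiv:math/0702720, §4:
  Lemma 4.2 ((4.2)), proof of Lemma 4.3 ((4.16), (4.17), the estimates of `J₁`, `J₂`, the main
  inequality) (arXiv p. 6). [`SereginZajaczkowski2007`]
-/

noncomputable section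

open MeasureTheory Set Function Filter Topology TopologicalSpace Metric WithLp
open scoped NNReal ENNReal ContDiff InnerProductSpace RealInnerProductSpace Laplacian

namespace Literature.Analysis.FluidPDE

namespace SereginZajaczkowski2007

open SereginSverak2009

/-- Local notation for physical space `ℝ³ = EuclideanSpace ℝ (Fin 3)`. -/
local notation "ℝ³" => EuclideanSpace ℝ (Fin 3)

/-- Local notation for the standard orthonormal basis of `ℝ³`. -/
local notation "𝐞" => EuclideanSpace.basisFun (Fin 3) ℝ

/-- Local notation: the shell `𝒞̃ = 𝒞(1/4, 3; 2)`. -/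
local notation "𝒞" => shell (1 / 4) 3 2

/-- Local notation: the cylinder `Q̃ = 𝒞̃ × ]-2², 0[` as an open set. -/
local notation "Q" => shellCylOpens (1 / 4) 3 2 2

/-- Local notation: the shell `𝒞̃₁ = 𝒞(5/16, 11/4; 7/4)`. -/
local notation "S₁" => shell (5 / 16) (11 / 4) (7 / 4)

/-! ### Pure real arithmetic of the Young-inequality bookkeeping -/

/-- **The arithmetic of "making use of Young's inequality"** in the proof of Lemma 4.3: from
`I + 3D ≤ 36(M+1)T₂ + 4(M+1)T₁`, the two families of Young bounds for `T₁`, `T₂` (free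
parameters `l, m > 0`), `P ≤ c(1+Y)D` ((4.17)), `A₁ ≤ K`, `G₁ ≤ G`, `Π ≤ Φ`, one gets
`I + D ≤ (1 + Φ + 12000(M+1)²(c+1)(1+K))(1+G)(1+Y)` (choose `m = 18(M+1)(c+1)(1+Y)`,
`l = 2(M+1)(c+1)(1+Y)`, so that the `P`-terms are absorbed by `2D`). [folklore] -/
theorem l4_energy_arith {M c Y D P A₁ G₁ Q₁ T₁ T₂ I K G Φ : ℝ}
    (hM : 0 ≤ M) (hc : 0 ≤ c) (hY : 0 ≤ Y) (hD : 0 ≤ D) (hA : 0 ≤ A₁)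
    (hG₁ : 0 ≤ G₁) (hQ : 0 ≤ Q₁) (hK : A₁ ≤ K) (hGG : G₁ ≤ G) (hQΦ : Q₁ ≤ Φ)
    (hPle : P ≤ c * (1 + Y) * D)
    (hI : I + 3 * D ≤ 36 * (M + 1) * T₂ + 4 * (M + 1) * T₁)
    (hT₁ : ∀ l : ℝ, 0 < l → T₁ ≤ 9 * l / 2 * A₁ + (P + Q₁) / (2 * l))
    (hT₂ : ∀ m : ℝ, 0 < m → T₂ ≤ m * (11 * A₁ + 18 * G₁) + (Y + P) / (2 * m)) :
    I + D ≤ (1 + Φ + 12000 * (M + 1) ^ 2 * (c + 1) * (1 + K)) * (1 + G) * (1 + Y) := by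
  set M' : ℝ := M + 1 with hM'
  set c' : ℝ := c + 1 with hc'
  have hM'0 : 0 < M' := by rw [hM']; linarith
  have hc'0 : 0 < c' := by rw [hc']; linarith
  have hY1 : 0 < 1 + Y := by linarith
  have hKnn : 0 ≤ K := hA.trans hK
  have hGnn : 0 ≤ G := hG₁.trans hGG
  have hΦnn : 0 ≤ Φ := hQ.trans hQΦ
  set m : ℝ := 18 * M' * c' * (1 + Y) with hm
  set l : ℝ := 2 * M' * c' * (1 + Y) with hl
  have hm0 : 0 < m := by rw [hm]; positivity
  have hl0 : 0 < l := by rw [hl]; positivity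
  have h2 := hT₂ m hm0
  have h1 := hT₁ l hl0
  -- `P ≤ c' (1 + Y) D`
  have hP' : P ≤ c' * (1 + Y) * D := by
    refine hPle.trans ?_
    have : c ≤ c' := by rw [hc']; linarith
    gcongr
  -- the `P`-terms are absorbed by `2D`
  have hPm : 36 * M' * ((Y + P) / (2 * m)) = (Y + P) / (c' * (1 + Y)) := by
    rw [hm]; field_simp; ring
  have hPl : 4 * M' * ((P + Q₁) / (2 * l)) = (P + Q₁) / (c' * (1 + Y)) := by
    rw [hl]; field_simp; ring
  have hden : 0 < c' * (1 + Y) := by positivity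
  have hfrac1 : P / (c' * (1 + Y)) ≤ D := by
    rw [div_le_iff₀ hden]; linarith
  have hfrac2 : Y / (c' * (1 + Y)) ≤ 1 := by
    rw [div_le_iff₀ hden]
    have : 1 ≤ c' := by rw [hc']; linarith
    nlinarith
  have hfrac3 : Q₁ / (c' * (1 + Y)) ≤ Φ := by
    rw [div_le_iff₀ hden]
    have : 1 ≤ c' * (1 + Y) := by
      have : 1 ≤ c' := by rw [hc']; linarith
      nlinarith
    nlinarith
  -- the `m`/`l` terms
  have hmterm : 36 * M' * (m * (11 * A₁ + 18 * G₁)) ≤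
      36 * 18 * 18 * M' ^ 2 * c' * (1 + Y) * (K + G) := by
    rw [hm]
    have h11 : 11 * A₁ + 18 * G₁ ≤ 18 * (K + G) := by linarith
    have h0 : 0 ≤ 36 * M' * (18 * M' * c' * (1 + Y)) := by positivity
    calc 36 * M' * (18 * M' * c' * (1 + Y) * (11 * A₁ + 18 * G₁))
        = 36 * M' * (18 * M' * c' * (1 + Y)) * (11 * A₁ + 18 * G₁) := by ring
      _ ≤ 36 * M' * (18 * M' * c' * (1 + Y)) * (18 * (K + G)) :=
          mul_le_mul_of_nonneg_left h11 h0
      _ = 36 * 18 * 18 * M' ^ 2 * c' * (1 + Y) * (K + G) := by ring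
  have hlterm : 4 * M' * (9 * l / 2 * A₁) ≤ 36 * M' ^ 2 * c' * (1 + Y) * K := by
    rw [hl]
    have h0 : 0 ≤ 36 * M' ^ 2 * c' * (1 + Y) := by positivity
    calc 4 * M' * (9 * (2 * M' * c' * (1 + Y)) / 2 * A₁) = 36 * M' ^ 2 * c' * (1 + Y) * A₁ := by
          ring
      _ ≤ 36 * M' ^ 2 * c' * (1 + Y) * K := mul_le_mul_of_nonneg_left hK h0
  -- assembling
  have hsum : I + 3 * D ≤ 2 * D + 1 + Φ +
      (36 * 18 * 18 + 36) * M' ^ 2 * c' * (1 + K) * (1 + G) * (1 + Y) := by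
    have e2 : 36 * M' * T₂ ≤
        36 * M' * (m * (11 * A₁ + 18 * G₁)) + 36 * M' * ((Y + P) / (2 * m)) := by
      have := mul_le_mul_of_nonneg_left h2 (by positivity : (0 : ℝ) ≤ 36 * M')
      linarith [this]
    have e1 : 4 * M' * T₁ ≤ 4 * M' * (9 * l / 2 * A₁) + 4 * M' * ((P + Q₁) / (2 * l)) := by
      have := mul_le_mul_of_nonneg_left h1 (by positivity : (0 : ℝ) ≤ 4 * M')
      linarith [this]
    rw [hPm] at e2
    rw [hPl] at e1
    have hsplit1 : (Y + P) / (c' * (1 + Y)) = Y / (c' * (1 + Y)) + P / (c' * (1 + Y)) := by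
      rw [add_div]
    have hsplit2 : (P + Q₁) / (c' * (1 + Y)) = P / (c' * (1 + Y)) + Q₁ / (c' * (1 + Y)) := by
      rw [add_div]
    rw [hsplit1] at e2
    rw [hsplit2] at e1
    have hbig : 36 * 18 * 18 * M' ^ 2 * c' * (1 + Y) * (K + G) + 36 * M' ^ 2 * c' * (1 + Y) * K ≤
        (36 * 18 * 18 + 36) * M' ^ 2 * c' * (1 + K) * (1 + G) * (1 + Y) := by
      have hexp : (1 + K) * (1 + G) = 1 + K + G + K * G := by ring
      have hKG0 : 0 ≤ K * G := mul_nonneg hKnn hGnn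
      have hKG : K + G ≤ (1 + K) * (1 + G) := by rw [hexp]; linarith only [hKG0, hKnn, hGnn]
      have hK1 : K ≤ (1 + K) * (1 + G) := by rw [hexp]; linarith only [hKG0, hKnn, hGnn]
      have e1 : 36 * 18 * 18 * M' ^ 2 * c' * (1 + Y) * (K + G) ≤
          36 * 18 * 18 * M' ^ 2 * c' * (1 + Y) * ((1 + K) * (1 + G)) :=
        mul_le_mul_of_nonneg_left hKG (by positivity)
      have e2 : 36 * M' ^ 2 * c' * (1 + Y) * K ≤ 36 * M' ^ 2 * c' * (1 + Y) * ((1 + K) * (1 + G)) :=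
        mul_le_mul_of_nonneg_left hK1 (by positivity)
      have e3 : 36 * 18 * 18 * M' ^ 2 * c' * (1 + Y) * ((1 + K) * (1 + G)) +
          36 * M' ^ 2 * c' * (1 + Y) * ((1 + K) * (1 + G)) =
          (36 * 18 * 18 + 36) * M' ^ 2 * c' * (1 + K) * (1 + G) * (1 + Y) := by ring
      linarith only [e1, e2, e3]
    have hI' : I + 3 * D ≤ 36 * M' * T₂ + 4 * M' * T₁ := by rw [hM']; exact hI
    linarith only [hI', e1, e2, hfrac1, hfrac2, hfrac3, hmterm, hlterm, hbig]
  have hconst : (36 * 18 * 18 + 36 : ℝ) ≤ 12000 := by norm_num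
  have h0 : 0 ≤ M' ^ 2 * c' * (1 + K) * (1 + G) * (1 + Y) := by positivity
  have hGY : 1 ≤ (1 + G) * (1 + Y) := by
    have hexp : (1 + G) * (1 + Y) = 1 + G + Y + G * Y := by ring
    rw [hexp]
    linarith only [mul_nonneg hGnn hY, hGnn, hY]
  have h1Φ : 1 + Φ ≤ (1 + Φ) * ((1 + G) * (1 + Y)) := by
    have h10 : 0 ≤ 1 + Φ := by linarith
    calc 1 + Φ = (1 + Φ) * 1 := (mul_one _).symm
      _ ≤ (1 + Φ) * ((1 + G) * (1 + Y)) := mul_le_mul_of_nonneg_left hGY h10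
  have hX : (36 * 18 * 18 + 36) * (M' ^ 2 * c' * (1 + K) * (1 + G) * (1 + Y)) ≤
      12000 * (M' ^ 2 * c' * (1 + K) * (1 + G) * (1 + Y)) := mul_le_mul_of_nonneg_right hconst h0
  have hR : (1 + Φ + 12000 * (M + 1) ^ 2 * (c + 1) * (1 + K)) * (1 + G) * (1 + Y) =
      (1 + Φ) * ((1 + G) * (1 + Y)) + 12000 * (M' ^ 2 * c' * (1 + K) * (1 + G) * (1 + Y)) := by
    rw [hM', hc']; ring
  have hL : (36 * 18 * 18 + 36) * M' ^ 2 * c' * (1 + K) * (1 + G) * (1 + Y) =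
      (36 * 18 * 18 + 36) * (M' ^ 2 * c' * (1 + K) * (1 + G) * (1 + Y)) := by ring
  rw [hR]
  rw [hL] at hsum
  linarith only [hsum, h1Φ, hX, hD]

/-! ### Lemma 4.2, chosen once: the function `Φ₁` -/

/-- **The function `Φ₁(q, 𝒜₂)` of Lemma 4.2**, extracted once and for all from the discharged
`OffAxisPoloidalBound_holds` by choice. [cite: SereginZajaczkowski2007, Lemma 4.2 ((4.2))] -/
def poloidalPhi : ℝ≥0 → ℝ≥0 → ℝ≥0 :=
  Classical.choose OffAxisPoloidalBound_holds

/-- The defining properties of `poloidalPhi` (monotonicity and the bound (4.2) for every `q ≥ 1`).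
[cite: SereginZajaczkowski2007, Lemma 4.2 ((4.2))] -/
theorem poloidalPhi_spec :
    (∀ q, Monotone (poloidalPhi q)) ∧ (∀ K, Monotone fun q => poloidalPhi q K) ∧
      ∀ (V : ℝ → ℝ³ → ℝ³) (P : ℝ → ℝ³ → ℝ),
        IsSmoothAxisymmetricSolutionOn (shellCylOpens (1 / 4) 3 2 2) V P →
        ∀ K : ℝ≥0, szEnergy V P (fun t x => fderiv ℝ (V t) x) ≤ K →
          ∀ q : ℝ≥0, 1 ≤ q → ∀ t ∈ Ioo (-(7 / 4 : ℝ) ^ 2) 0,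
            ∫⁻ x in shell (5 / 16) (11 / 4) (7 / 4), ‖poloidalSpeed (V t) x‖ₑ ^ (q : ℝ) ≤
              poloidalPhi q K :=
  Classical.choose_spec OffAxisPoloidalBound_holds

/-- **Lemma 4.2 at `q = 20`**: `∫_{𝒞̃₁} |V^a(x, t)|²⁰ dx ≤ Φ₁(20, K)` for `-(7/4)² < t < 0`.
[cite: SereginZajaczkowski2007, Lemma 4.2 ((4.2), q = 20)] -/
theorem setLIntegral_poloidalSpeed_twenty_le {V : ℝ → ℝ³ → ℝ³} {P : ℝ → ℝ³ → ℝ}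
    (hV : IsSmoothAxisymmetricSolutionOn Q V P) {K : ℝ≥0}
    (hK : szEnergy V P (fun t x => fderiv ℝ (V t) x) ≤ K) {t : ℝ}
    (ht : t ∈ Ioo (-(7 / 4 : ℝ) ^ 2) 0) :
    ∫⁻ x in S₁, ‖poloidalSpeed (V t) x‖ₑ ^ ((20 : ℝ≥0) : ℝ) ≤ poloidalPhi 20 K :=
  poloidalPhi_spec.2.2 V P hV K hK 20 (by norm_num) t ht

/-- **The kernel constant of the `L⁴`-energy inequality**:
`A(K) = 1 + Φ₁(20, K) + 12000 (M + 1)² (c + 1)(1 + K)`, `c` the constant of (4.17), `M` the slab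
bound of the cut-off data. [folklore] -/
def l4KernelConst (M : ℝ) (K : ℝ≥0) : ℝ≥0 :=
  1 + poloidalPhi 20 K + 12000 * (Real.toNNReal M + 1) ^ 2 * (gnTenThirdsConst + 1) * (1 + K)

/-- `A` is monotone in `K`. [folklore] -/
theorem monotone_l4KernelConst (M : ℝ) : Monotone (l4KernelConst M) := by
  intro K K' hKK'
  unfold l4KernelConst
  have h1 : poloidalPhi 20 K ≤ poloidalPhi 20 K' := poloidalPhi_spec.1 20 hKK'
  gcongr

/-! ### Pointwise inequalities -/

section Pointwise

/-- **Young's inequality with a parameter**: `ab ≤ (l/2)a² + b²/(2l)`, `l > 0`. [folklore] -/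
theorem mul_le_young (a b : ℝ) {l : ℝ} (hl : 0 < l) : a * b ≤ l / 2 * a ^ 2 + b ^ 2 / (2 * l) := by
  rw [show l / 2 * a ^ 2 + b ^ 2 / (2 * l) = (l ^ 2 * a ^ 2 + b ^ 2) / (2 * l) by
    field_simp]
  rw [le_div_iff₀ (by positivity)]
  nlinarith [sq_nonneg (l * a - b)]

/-- `b³ v² ≤ b^{10/3} + v²⁰` for `b, v ≥ 0` (the case split `v² ≤ b^{1/3}` or not; this is how
the exponent `20` of Lemma 4.2 enters). [folklore] -/
theorem pow_three_mul_sq_le (b v : ℝ) (hb : 0 ≤ b) :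
    b ^ 3 * v ^ 2 ≤ b ^ (10 / 3 : ℝ) + v ^ 20 := by
  set r : ℝ := b ^ (1 / 3 : ℝ) with hr
  have hr0 : 0 ≤ r := Real.rpow_nonneg hb _
  have hr3 : r ^ 3 = b := by
    rw [hr, ← Real.rpow_natCast, ← Real.rpow_mul hb]
    norm_num
  have hr10 : b ^ (10 / 3 : ℝ) = r ^ 10 := by
    rw [hr, ← Real.rpow_natCast, ← Real.rpow_mul hb]
    norm_num
  rw [hr10, ← hr3]
  have hv2 : 0 ≤ v ^ 2 := sq_nonneg _
  rcases le_or_gt (v ^ 2) r with h | h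
  · have h1 : (r ^ 3) ^ 3 * v ^ 2 ≤ (r ^ 3) ^ 3 * r :=
      mul_le_mul_of_nonneg_left h (by positivity)
    have h2 : (r ^ 3) ^ 3 * r = r ^ 10 := by ring
    have h3 : 0 ≤ v ^ 20 := by positivity
    linarith
  · have h1 : r ^ 9 ≤ (v ^ 2) ^ 9 := pow_le_pow_left₀ hr0 h.le 9
    have h2 : (r ^ 3) ^ 3 * v ^ 2 ≤ (v ^ 2) ^ 9 * v ^ 2 := by
      rw [show (r ^ 3) ^ 3 = r ^ 9 by ring]
      exact mul_le_mul_of_nonneg_right h1 hv2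
    have h3 : (v ^ 2) ^ 9 * v ^ 2 = v ^ 20 := by ring
    have h4 : 0 ≤ r ^ 10 := by positivity
    linarith

/-- `b³ ≤ b² + b^{10/3}` for `b ≥ 0`. [folklore] -/
theorem pow_three_le_sq_add_rpow (b : ℝ) (hb : 0 ≤ b) : b ^ 3 ≤ b ^ 2 + b ^ (10 / 3 : ℝ) := by
  have h10 : 0 ≤ b ^ (10 / 3 : ℝ) := Real.rpow_nonneg hb _
  rcases le_or_gt b 1 with h | h
  · have : b ^ 3 ≤ b ^ 2 := pow_le_pow_of_le_one hb h (by norm_num)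
    linarith
  · have h3 : b ^ (3 : ℝ) = b ^ 3 := by exact_mod_cast Real.rpow_natCast b 3
    have h4 : b ^ (3 : ℝ) ≤ b ^ (10 / 3 : ℝ) :=
      Real.rpow_le_rpow_of_exponent_le h.le (by norm_num)
    rw [h3] at h4
    nlinarith [sq_nonneg b]

/-- `y^{2/3} ≤ 1 + y` for `y ≥ 0`. [folklore] -/
theorem rpow_two_thirds_le (y : ℝ) (hy : 0 ≤ y) : y ^ (2 / 3 : ℝ) ≤ 1 + y := by
  rcases le_or_gt y 1 with h | h
  · have : y ^ (2 / 3 : ℝ) ≤ 1 := Real.rpow_le_one hy h (by norm_num)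
    linarith
  · have : y ^ (2 / 3 : ℝ) ≤ y ^ (1 : ℝ) := Real.rpow_le_rpow_of_exponent_le h.le (by norm_num)
    rw [Real.rpow_one] at this
    linarith

/-- The cylindrical radius is at most the norm (the tree's `SereginSverak2009.cylRadius_le_norm'`
of `SereginSverakBlowupSelection.lean`, restated to keep the imports of this file inside the
Seregin–Zajaczkowski cone). [folklore] -/
theorem cylRadius_le_norm' (h : ℝ³) : cylRadius h ≤ ‖h‖ := by
  have h1 : cylRadius h ^ 2 ≤ ‖h‖ ^ 2 := by
    rw [cylRadius_sq, norm_sq_eq_sum_sq]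
    simp only [Fin.sum_univ_three]
    nlinarith [sq_nonneg (h 2)]
  exact le_of_pow_le_pow_left₀ two_ne_zero (norm_nonneg _) h1

/-- For a linear map of `ℝ³`, `‖L‖² ≤ |L|²` (operator norm versus Frobenius norm; the tree's
`SereginSverak2009.opNorm_sq_le_frobeniusNormSq'` of `SereginSverakAxisWeightedCubic.lean`, restated
to keep the imports of this file inside the Seregin–Zajaczkowski cone). [folklore] -/
theorem opNorm_sq_le_frobeniusNormSq (L : ℝ³ →L[ℝ] ℝ³) : ‖L‖ ^ 2 ≤ frobeniusNormSq L := by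
  rw [frobeniusNormSq_eq_sum_basisFun]
  have hS0 : 0 ≤ ∑ i, ‖L (𝐞 i)‖ ^ 2 := Finset.sum_nonneg fun i _ => sq_nonneg _
  have hle : ‖L‖ ≤ Real.sqrt (∑ i, ‖L (𝐞 i)‖ ^ 2) := by
    refine ContinuousLinearMap.opNorm_le_bound _ (Real.sqrt_nonneg _) fun v => ?_
    have hv : L v = ∑ i, v i • L (𝐞 i) := by
      conv_lhs => rw [show v = ∑ i, v i • (𝐞 i : ℝ³) from ((𝐞).sum_repr v).symm]
      simp [map_sum, map_smul]
    rw [hv]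
    refine (norm_sum_le _ _).trans ?_
    have hcs := Real.sum_mul_le_sqrt_mul_sqrt Finset.univ (fun i => |v i|) (fun i => ‖L (𝐞 i)‖)
    have hn : Real.sqrt (∑ i, |v i| ^ 2) = ‖v‖ := by
      simp only [sq_abs]
      rw [← norm_sq_eq_sum_sq v, Real.sqrt_sq (norm_nonneg _)]
    rw [hn] at hcs
    calc ∑ i, ‖v i • L (𝐞 i)‖ = ∑ i, |v i| * ‖L (𝐞 i)‖ := by
          refine Finset.sum_congr rfl fun i _ => ?_
          rw [norm_smul, Real.norm_eq_abs]
      _ ≤ ‖v‖ * Real.sqrt (∑ i, ‖L (𝐞 i)‖ ^ 2) := hcs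
      _ = Real.sqrt (∑ i, ‖L (𝐞 i)‖ ^ 2) * ‖v‖ := mul_comm _ _
  calc ‖L‖ ^ 2 ≤ Real.sqrt (∑ i, ‖L (𝐞 i)‖ ^ 2) ^ 2 := pow_le_pow_left₀ (norm_nonneg _) hle 2
    _ = ∑ i, ‖L (𝐞 i)‖ ^ 2 := Real.sq_sqrt hS0

/-- **`|α| ≤ 3|V|` on `𝒞̃`** (`α = ϱV_φ = ⟪Jx, V⟫`, `‖Jx‖ = ϱ < 3`): `α² ≤ 9‖V‖²`. [folklore] -/
theorem swirl_sq_le (u : ℝ³ → ℝ³) {x : ℝ³} (hx : x ∈ 𝒞) : swirl u x ^ 2 ≤ 9 * ‖u x‖ ^ 2 := by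
  have h1 : |swirl u x| ≤ 3 * ‖u x‖ := by
    rw [swirl_eq_inner_rotGen]
    refine (abs_real_inner_le_norm _ _).trans ?_
    rw [norm_rotGen_eq]
    exact mul_le_mul_of_nonneg_right (cylRadius_lt_of_mem_shell hx).le (norm_nonneg _)
  nlinarith [abs_nonneg (swirl u x), sq_abs (swirl u x), norm_nonneg (u x)]

/-- **`‖∇α‖ ≤ 3‖∇V‖ + |V|` on `𝒞̃`** (`Dα h = ⟪Jx, DV h⟫ + ⟪Jh, V⟫`). [folklore] -/
theorem norm_fderiv_swirl_le {u : ℝ³ → ℝ³} {x : ℝ³} (hd : DifferentiableAt ℝ u x) (hx : x ∈ 𝒞) :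
    ‖fderiv ℝ (swirl u) x‖ ≤ 3 * ‖fderiv ℝ u x‖ + ‖u x‖ := by
  refine ContinuousLinearMap.opNorm_le_bound _ (by positivity) fun h => ?_
  rw [fderiv_swirl_apply hd h]
  refine (norm_add_le _ _).trans ?_
  have h1 : ‖⟪rotGen x, fderiv ℝ u x h⟫‖ ≤ 3 * ‖fderiv ℝ u x‖ * ‖h‖ := by
    refine (norm_inner_le_norm _ _).trans ?_
    rw [norm_rotGen_eq]
    calc cylRadius x * ‖fderiv ℝ u x h‖ ≤ 3 * (‖fderiv ℝ u x‖ * ‖h‖) :=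
          mul_le_mul (cylRadius_lt_of_mem_shell hx).le ((fderiv ℝ u x).le_opNorm h)
            (norm_nonneg _) (by norm_num)
      _ = 3 * ‖fderiv ℝ u x‖ * ‖h‖ := by ring
  have h2 : ‖⟪rotGen h, u x⟫‖ ≤ ‖u x‖ * ‖h‖ := by
    refine (norm_inner_le_norm _ _).trans ?_
    rw [norm_rotGen_eq, mul_comm]
    exact mul_le_mul_of_nonneg_left (cylRadius_le_norm' h) (norm_nonneg _)
  linarith

/-- `α² + ‖∇α‖² ≤ 11‖V‖² + 18|∇V|²` on `𝒞̃`. [folklore] -/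
theorem swirl_sq_add_norm_fderiv_sq_le {u : ℝ³ → ℝ³} {x : ℝ³} (hd : DifferentiableAt ℝ u x)
    (hx : x ∈ 𝒞) :
    swirl u x ^ 2 + ‖fderiv ℝ (swirl u) x‖ ^ 2 ≤
      11 * ‖u x‖ ^ 2 + 18 * frobeniusNormSq (fderiv ℝ u x) := by
  have h1 := swirl_sq_le u hx
  have h2 := norm_fderiv_swirl_le hd hx
  have h3 := opNorm_sq_le_frobeniusNormSq (fderiv ℝ u x)
  have h4 : ‖fderiv ℝ (swirl u) x‖ ^ 2 ≤ (3 * ‖fderiv ℝ u x‖ + ‖u x‖) ^ 2 :=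
    pow_le_pow_left₀ (norm_nonneg _) h2 2
  nlinarith [norm_nonneg (fderiv ℝ u x), norm_nonneg (u x),
    sq_nonneg (3 * ‖fderiv ℝ u x‖ - ‖u x‖)]

/-- **Young for the `J₁`-integrand**: for `x ∈ 𝒞̃`, `b = β̃ = f² ≥ 0`, `v = |V^a| ≥ 0` and `l > 0`,
`|f|³ (|α| v) ≤ (9l/2)‖V‖² + (b^{10/3} + v²⁰)/(2l)`. [folklore] -/
theorem young_J₁ {u : ℝ³ → ℝ³} {x : ℝ³} (hx : x ∈ 𝒞) (f v : ℝ) {l : ℝ} (hl : 0 < l) :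
    |f| ^ 3 * (|swirl u x| * v) ≤
      9 * l / 2 * ‖u x‖ ^ 2 + ((f ^ 2) ^ (10 / 3 : ℝ) + v ^ 20) / (2 * l) := by
  have hy := mul_le_young |swirl u x| (|f| ^ 3 * v) hl
  have hα := swirl_sq_le u hx
  have hb := pow_three_mul_sq_le (f ^ 2) v (sq_nonneg f)
  have hf6 : (|f| ^ 3 * v) ^ 2 = (f ^ 2) ^ 3 * v ^ 2 := by
    rw [mul_pow, ← pow_mul, show 3 * 2 = 6 by norm_num, show |f| ^ 6 = f ^ 6 from
      Even.pow_abs ⟨3, rfl⟩ f]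
    ring
  rw [sq_abs] at hy
  rw [hf6] at hy
  have h2l : 0 < 2 * l := by positivity
  have hdiv : (f ^ 2) ^ 3 * v ^ 2 / (2 * l) ≤ ((f ^ 2) ^ (10 / 3 : ℝ) + v ^ 20) / (2 * l) :=
    div_le_div_of_nonneg_right hb h2l.le
  calc |f| ^ 3 * (|swirl u x| * v) = |swirl u x| * (|f| ^ 3 * v) := by ring
    _ ≤ l / 2 * swirl u x ^ 2 + (f ^ 2) ^ 3 * v ^ 2 / (2 * l) := hy
    _ ≤ l / 2 * (9 * ‖u x‖ ^ 2) + ((f ^ 2) ^ (10 / 3 : ℝ) + v ^ 20) / (2 * l) := by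
        gcongr
    _ = 9 * l / 2 * ‖u x‖ ^ 2 + ((f ^ 2) ^ (10 / 3 : ℝ) + v ^ 20) / (2 * l) := by ring

/-- **Young for the `J₂`-integrand**: for `x ∈ 𝒞̃` with `V` differentiable there, `b = f² ≥ 0`
and `m > 0`, `|f|³ (|α| + ‖∇α‖) ≤ m(11‖V‖² + 18|∇V|²) + (b² + b^{10/3})/(2m)`. [folklore] -/
theorem young_J₂ {u : ℝ³ → ℝ³} {x : ℝ³} (hd : DifferentiableAt ℝ u x) (hx : x ∈ 𝒞) (f : ℝ)
    {m : ℝ} (hm : 0 < m) :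
    |f| ^ 3 * (|swirl u x| + ‖fderiv ℝ (swirl u) x‖) ≤
      m * (11 * ‖u x‖ ^ 2 + 18 * frobeniusNormSq (fderiv ℝ u x)) +
        ((f ^ 2) ^ 2 + (f ^ 2) ^ (10 / 3 : ℝ)) / (2 * m) := by
  have hy := mul_le_young (|swirl u x| + ‖fderiv ℝ (swirl u) x‖) (|f| ^ 3) hm
  have hsum := swirl_sq_add_norm_fderiv_sq_le hd hx
  have hb := pow_three_le_sq_add_rpow (f ^ 2) (sq_nonneg f)
  have hf6 : (|f| ^ 3) ^ 2 = (f ^ 2) ^ 3 := by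
    rw [← pow_mul, show 3 * 2 = 6 by norm_num, show |f| ^ 6 = f ^ 6 from Even.pow_abs ⟨3, rfl⟩ f]
    ring
  rw [hf6] at hy
  have hsq : (|swirl u x| + ‖fderiv ℝ (swirl u) x‖) ^ 2 ≤
      2 * (swirl u x ^ 2 + ‖fderiv ℝ (swirl u) x‖ ^ 2) := by
    rw [← sq_abs (swirl u x)]
    nlinarith [sq_nonneg (|swirl u x| - ‖fderiv ℝ (swirl u) x‖)]
  have h2m : 0 < 2 * m := by positivity
  have hdiv : (f ^ 2) ^ 3 / (2 * m) ≤ ((f ^ 2) ^ 2 + (f ^ 2) ^ (10 / 3 : ℝ)) / (2 * m) :=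
    div_le_div_of_nonneg_right hb h2m.le
  calc |f| ^ 3 * (|swirl u x| + ‖fderiv ℝ (swirl u) x‖)
      = (|swirl u x| + ‖fderiv ℝ (swirl u) x‖) * |f| ^ 3 := by ring
    _ ≤ m / 2 * (|swirl u x| + ‖fderiv ℝ (swirl u) x‖) ^ 2 + (f ^ 2) ^ 3 / (2 * m) := hy
    _ ≤ m / 2 * (2 * (11 * ‖u x‖ ^ 2 + 18 * frobeniusNormSq (fderiv ℝ u x))) +
          ((f ^ 2) ^ 2 + (f ^ 2) ^ (10 / 3 : ℝ)) / (2 * m) := by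
        gcongr
        exact hsq.trans (by linarith)
    _ = m * (11 * ‖u x‖ ^ 2 + 18 * frobeniusNormSq (fderiv ℝ u x)) +
          ((f ^ 2) ^ 2 + (f ^ 2) ^ (10 / 3 : ℝ)) / (2 * m) := by ring

end Pointwise

/-! ### Integrals at a fixed time -/

section FixedTime

variable {ψ : ℝ × ℝ³ → ℝ} {C : Set ℝ³} {t₀ M : ℝ}
variable {V : ℝ → ℝ³ → ℝ³} {P : ℝ → ℝ³ → ℝ}

/-- Times of `]-(7/4)², 0[` are times of `]-2², 0[`. [folklore] -/
theorem mem_Ioo_four_of_mem {t : ℝ} (ht : t ∈ Ioo (-(7 / 4 : ℝ) ^ 2) 0) :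
    t ∈ Ioo (-(2 : ℝ) ^ 2) 0 :=
  ⟨by linarith [ht.1], ht.2⟩

/-- **Comparison with an integral over `𝒞̃₁`**: if `h` is integrable, vanishes off `𝒞̃₁`, and
`h ≤ g` on `𝒞̃₁` with `g` integrable there, then `∫ h ≤ ∫_{𝒞̃₁} g`. [folklore] -/
theorem integral_le_setIntegral_shellOne {h g : ℝ³ → ℝ} (hh : Integrable h)
    (hzero : ∀ x ∉ S₁, h x = 0) (hg : IntegrableOn g S₁) (hle : ∀ x ∈ S₁, h x ≤ g x) :
    ∫ x, h x ≤ ∫ x in S₁, g x := by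
  rw [← setIntegral_eq_integral_of_forall_compl_eq_zero (s := S₁) fun x hx => hzero x hx]
  exact setIntegral_mono_on hh.integrableOn hg (isOpen_shell _ _ _).measurableSet hle

/-- The poloidal speed of a field continuous on `𝒞̃` is continuous on `𝒞̃`. [folklore] -/
theorem continuousOn_poloidalSpeed {v : ℝ³ → ℝ³} (hv : ContinuousOn v 𝒞) :
    ContinuousOn (poloidalSpeed v) 𝒞 := by
  have h3 : ContinuousOn (fun x => axialVelocity v x) 𝒞 :=
    (EuclideanSpace.proj (2 : Fin 3)).continuous.comp_continuousOn hv
  have h : ContinuousOn (fun x => Real.sqrt (radialVelocity v x ^ 2 + axialVelocity v x ^ 2)) 𝒞 :=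
    (((continuousOn_radialVelocity hv).pow 2).add (h3.pow 2)).sqrt
  exact h

namespace SwirlCutoffData

variable (d : SwirlCutoffData ψ C t₀ M)
include d

/-- `𝒞̃₁`-support: `α̃(t, x) = 0` for `x ∉ 𝒞̃₁`. [folklore] -/
theorem alphaTilde_eq_zero_of_notMem_shellOne (V : ℝ → ℝ³ → ℝ³) (t : ℝ) {x : ℝ³} (hx : x ∉ S₁) :
    alphaTilde ψ V t x = 0 :=
  d.alphaTilde_eq_zero V t fun h => hx (d.subset h)

/-- Integrability of `|α̃|³ g` for `g` continuous on `𝒞̃`. [folklore] -/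
theorem integrable_abs_pow_three_mul (hV : IsSmoothAxisymmetricSolutionOn Q V P) {t : ℝ}
    (ht : t ∈ Ioo (-(2 : ℝ) ^ 2) 0) {g : ℝ³ → ℝ} (hg : ContinuousOn g 𝒞) :
    Integrable fun x => |alphaTilde ψ V t x| ^ 3 * g x := by
  have hfc : Continuous (alphaTilde ψ V t) := (d.contDiff_alphaTilde hV ht (n := 0)).continuous
  have hcpt : HasCompactSupport fun x => |alphaTilde ψ V t x| ^ 3 :=
    (d.hasCompactSupport_alphaTilde V t).comp_left (g := fun r : ℝ => |r| ^ 3) (by simp)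
  have hts : tsupport (fun x => |alphaTilde ψ V t x| ^ 3) ⊆ 𝒞 := by
    refine (closure_mono ?_).trans (d.tsupport_alphaTilde_subset_shell V t)
    exact Function.support_comp_subset (g := fun r : ℝ => |r| ^ 3) (by simp) _
  exact integrable_cutoff_mul ((continuous_abs.comp hfc).pow 3) hcpt hts hg

omit d in
/-- `x ↦ ∇α(t, ·)(x)` (as a linear map) is continuous on `𝒞̃`. [folklore] -/
theorem continuousOn_fderiv_swirl_slice (hV : IsSmoothAxisymmetricSolutionOn Q V P) {t : ℝ}
    (ht : t ∈ Ioo (-(2 : ℝ) ^ 2) 0) : ContinuousOn (fun x => fderiv ℝ (swirl (V t)) x) 𝒞 := by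
  have hVc : ContinuousOn (V t) 𝒞 := hV.continuousOn_slice ht
  have hDc : ContinuousOn (fun x => fderiv ℝ (V t) x) 𝒞 := hV.continuousOn_fderiv_slice' ht
  have htriple : ContinuousOn (fun x : ℝ³ => (x, V t x, fderiv ℝ (V t) x)) 𝒞 :=
    continuousOn_id.prodMk (hVc.prodMk hDc)
  have hsw : ContinuousOn (fun x : ℝ³ => swirlFDeriv x (V t x) (fderiv ℝ (V t) x)) 𝒞 :=
    Continuous.comp_continuousOn
      (g := fun p : ℝ³ × ℝ³ × (ℝ³ →L[ℝ] ℝ³) => swirlFDeriv p.1 p.2.1 p.2.2)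
      (f := fun x : ℝ³ => (x, V t x, fderiv ℝ (V t) x)) continuous_swirlFDeriv htriple
  refine hsw.congr fun x hx => ?_
  exact (hasFDerivAt_swirl (hV.differentiableAt_slice ht hx).hasFDerivAt).fderiv

/-- **The remainder integral is controlled by the two Young-type integrals**:
`∫ α̃³ R ≤ 9M ∫ |α̃|³(|α| + ‖∇α‖) + M ∫ |α̃|³ |α| |V^a|`.
[cite: SereginZajaczkowski2007, proof of Lemma 4.3 (the estimates of J₁, J₂)] -/
theorem integral_pow_three_mul_l4Remainder_le (hV : IsSmoothAxisymmetricSolutionOn Q V P) {t : ℝ}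
    (ht : t ∈ Ioo (-(2 : ℝ) ^ 2) 0) :
    ∫ x, alphaTilde ψ V t x ^ 3 * l4Remainder ψ V t x ≤
      9 * M * (∫ x, |alphaTilde ψ V t x| ^ 3 *
          (|swirl (V t) x| + ‖fderiv ℝ (swirl (V t)) x‖)) +
        M * ∫ x, |alphaTilde ψ V t x| ^ 3 * (|swirl (V t) x| * poloidalSpeed (V t) x) := by
  have hsw : ContinuousOn (fun x => swirl (V t) x) 𝒞 :=
    continuousOn_slice_of_continuousOn hV.continuousOn_swirl ht
  have hg₂ : ContinuousOn (fun x => |swirl (V t) x| + ‖fderiv ℝ (swirl (V t)) x‖) 𝒞 :=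
    hsw.abs.add (continuousOn_fderiv_swirl_slice hV ht).norm
  have hg₁ : ContinuousOn (fun x => |swirl (V t) x| * poloidalSpeed (V t) x) 𝒞 :=
    hsw.abs.mul (continuousOn_poloidalSpeed (hV.continuousOn_slice ht))
  have i0 : Integrable fun x => alphaTilde ψ V t x ^ 3 * l4Remainder ψ V t x :=
    d.integrable_pow_mul hV ht three_ne_zero (d.continuousOn_l4Remainder hV ht)
  have i2 := d.integrable_abs_pow_three_mul hV ht hg₂
  have i1 := d.integrable_abs_pow_three_mul hV ht hg₁
  have hpt : ∀ x, alphaTilde ψ V t x ^ 3 * l4Remainder ψ V t x ≤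
      9 * M * (|alphaTilde ψ V t x| ^ 3 * (|swirl (V t) x| + ‖fderiv ℝ (swirl (V t)) x‖)) +
        M * (|alphaTilde ψ V t x| ^ 3 * (|swirl (V t) x| * poloidalSpeed (V t) x)) := by
    intro x
    by_cases hx : x ∈ C
    · have hR := d.abs_l4Remainder_le V ht hx
      have habs : alphaTilde ψ V t x ^ 3 * l4Remainder ψ V t x ≤
          |alphaTilde ψ V t x| ^ 3 * |l4Remainder ψ V t x| := by
        rw [← abs_pow, ← abs_mul]
        exact le_abs_self _
      have h0 : 0 ≤ |alphaTilde ψ V t x| ^ 3 := by positivity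
      have := mul_le_mul_of_nonneg_left hR h0
      linarith
    · rw [d.alphaTilde_eq_zero V t hx]
      simp
  calc ∫ x, alphaTilde ψ V t x ^ 3 * l4Remainder ψ V t x
      ≤ ∫ x, (9 * M * (|alphaTilde ψ V t x| ^ 3 * (|swirl (V t) x| + ‖fderiv ℝ (swirl (V t)) x‖)) +
          M * (|alphaTilde ψ V t x| ^ 3 * (|swirl (V t) x| * poloidalSpeed (V t) x))) :=
        integral_mono i0 ((i2.const_mul _).add (i1.const_mul _)) hpt
    _ = _ := by
        rw [integral_add (i2.const_mul _) (i1.const_mul _), integral_const_mul, integral_const_mul]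

/-! #### The real quantities and their `ℝ≥0∞` counterparts -/

/-- `β̃(t, ·)` is continuous with compact support inside `C`; its square and its `10/3`-power are
integrable, and so is `‖∇β̃‖²`. [folklore] -/
theorem continuous_betaTilde (hV : IsSmoothAxisymmetricSolutionOn Q V P) {t : ℝ}
    (ht : t ∈ Ioo (-(2 : ℝ) ^ 2) 0) : Continuous (betaTilde ψ V t) :=
  ((d.contDiff_alphaTilde hV ht (n := 0)).continuous).pow 2

omit d in
/-- `β̃(t, x) = 0` off `C`. [folklore] -/
theorem betaTilde_eq_zero' (d : SwirlCutoffData ψ C t₀ M) (V : ℝ → ℝ³ → ℝ³) (t : ℝ) {x : ℝ³}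
    (hx : x ∉ C) : betaTilde ψ V t x = 0 := by
  rw [betaTilde, d.alphaTilde_eq_zero V t hx, zero_pow two_ne_zero]

/-- `β̃(t, ·)` has compact support. [folklore] -/
theorem hasCompactSupport_betaTilde' (V : ℝ → ℝ³ → ℝ³) (t : ℝ) :
    HasCompactSupport (betaTilde ψ V t) :=
  HasCompactSupport.intro d.isCompact fun _ hx => d.betaTilde_eq_zero' V t hx

/-- **`Y` as a real integral**: `swirlEnergy ψ V t = ofReal (∫ β̃(t, x)² dx)`. [folklore] -/
theorem swirlEnergy_eq_ofReal (hV : IsSmoothAxisymmetricSolutionOn Q V P) {t : ℝ}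
    (ht : t ∈ Ioo (-(2 : ℝ) ^ 2) 0) :
    swirlEnergy ψ V t = ENNReal.ofReal (∫ x, betaTilde ψ V t x ^ 2) := by
  have hc := d.continuous_betaTilde hV ht
  have hcpt : HasCompactSupport fun x => betaTilde ψ V t x ^ 2 :=
    (d.hasCompactSupport_betaTilde' V t).comp_left (g := fun r : ℝ => r ^ 2) (by simp)
  have i2 : Integrable fun x => betaTilde ψ V t x ^ 2 := (hc.pow 2).integrable_of_hasCompactSupport hcpt
  have heq : ∀ x, ‖betaTilde ψ V t x‖ₑ ^ 2 = ENNReal.ofReal (betaTilde ψ V t x ^ 2) := fun x => by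
    rw [Real.enorm_eq_ofReal_abs, ← ENNReal.ofReal_pow (abs_nonneg _), sq_abs]
  unfold swirlEnergy
  simp_rw [heq]
  rw [setLIntegral_eq_of_support_subset]
  · exact (ofReal_integral_eq_lintegral_ofReal i2 (Eventually.of_forall fun x => sq_nonneg _)).symm
  · intro x hx
    by_contra h
    refine hx ?_
    show ENNReal.ofReal (betaTilde ψ V t x ^ 2) = 0
    rw [d.betaTilde_eq_zero' V t fun h' => h (d.subset h'), zero_pow two_ne_zero, ENNReal.ofReal_zero]

/-- **`D` as a real integral**: `swirlDissipation ψ V t = ofReal (∫ ‖∇ₓβ̃(t, x)‖² dx)`.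
[folklore] -/
theorem swirlDissipation_eq_ofReal (hV : IsSmoothAxisymmetricSolutionOn Q V P) {t : ℝ}
    (ht : t ∈ Ioo (-(2 : ℝ) ^ 2) 0) :
    swirlDissipation ψ V t = ENNReal.ofReal (∫ x, ‖fderiv ℝ (betaTilde ψ V t) x‖ ^ 2) := by
  have hb : betaTilde ψ V t = fun y => alphaTilde ψ V t y ^ 2 := rfl
  have hβs : ContDiff ℝ 1 (betaTilde ψ V t) := by
    rw [hb]; exact (d.contDiff_alphaTilde hV ht (n := 1)).pow 2
  have hβcpt := d.hasCompactSupport_betaTilde' V t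
  have hcptD : HasCompactSupport fun x => ‖fderiv ℝ (betaTilde ψ V t) x‖ ^ 2 := by
    refine (hβcpt.fderiv (𝕜 := ℝ)).norm.comp_left (g := fun r : ℝ => r ^ 2) ?_
    norm_num
  have iD : Integrable fun x => ‖fderiv ℝ (betaTilde ψ V t) x‖ ^ 2 :=
    ((hβs.continuous_fderiv one_ne_zero).norm.pow 2).integrable_of_hasCompactSupport hcptD
  have heq : ∀ x, ‖fderiv ℝ (betaTilde ψ V t) x‖ₑ ^ 2 =
      ENNReal.ofReal (‖fderiv ℝ (betaTilde ψ V t) x‖ ^ 2) := fun x => by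
    rw [← ofReal_norm, ENNReal.ofReal_pow (norm_nonneg _)]
  unfold swirlDissipation
  simp_rw [heq]
  rw [setLIntegral_eq_of_support_subset]
  · exact (ofReal_integral_eq_lintegral_ofReal iD (Eventually.of_forall fun x => sq_nonneg _)).symm
  · intro x hx
    by_contra h
    refine hx ?_
    show ENNReal.ofReal (‖fderiv ℝ (betaTilde ψ V t) x‖ ^ 2) = 0
    have hts : tsupport (betaTilde ψ V t) ⊆ C :=
      closure_minimal (fun y hy => by_contra fun h' => hy (d.betaTilde_eq_zero' V t h'))
        d.isCompact.isClosed
    have hx' : x ∉ tsupport (betaTilde ψ V t) := fun h' => h (d.subset (hts h'))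
    rw [fderiv_of_notMem_tsupport ℝ hx', norm_zero, zero_pow two_ne_zero, ENNReal.ofReal_zero]

/-- **(4.17) in real form**: `∫ β̃^{10/3} ≤ c (1 + Y) D` with `Y = ∫ β̃²`, `D = ∫ ‖∇β̃‖²`,
`c = gnTenThirdsConst` (from the `ℝ≥0∞` slice inequality `setLIntegral_betaTilde_rpow_le` and
`Y^{2/3} ≤ 1 + Y`). [cite: SereginZajaczkowski2007, proof of Lemma 4.3, (4.17)] -/
theorem integral_betaTilde_rpow_le (hψ : IsSwirlCutoff ψ) (hV : IsSmoothAxisymmetricSolutionOn Q V P)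
    {t : ℝ} (ht : t ∈ Ioo (-(7 / 4 : ℝ) ^ 2) 0) :
    (Integrable fun x => betaTilde ψ V t x ^ (10 / 3 : ℝ)) ∧
    ∫ x, betaTilde ψ V t x ^ (10 / 3 : ℝ) ≤
      (gnTenThirdsConst : ℝ) * (1 + ∫ x, betaTilde ψ V t x ^ 2) *
        ∫ x, ‖fderiv ℝ (betaTilde ψ V t) x‖ ^ 2 := by
  have ht4 := mem_Ioo_four_of_mem ht
  have hc := d.continuous_betaTilde hV ht4
  have hβcpt := d.hasCompactSupport_betaTilde' V t
  have hnn : ∀ x, 0 ≤ betaTilde ψ V t x := fun x => betaTilde_nonneg _ _ _ _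
  have hcP : Continuous fun x => betaTilde ψ V t x ^ (10 / 3 : ℝ) :=
    hc.rpow_const fun x => Or.inr (by norm_num)
  have hcptP : HasCompactSupport fun x => betaTilde ψ V t x ^ (10 / 3 : ℝ) :=
    hβcpt.comp_left (g := fun r : ℝ => r ^ (10 / 3 : ℝ)) (Real.zero_rpow (by norm_num))
  have iP : Integrable fun x => betaTilde ψ V t x ^ (10 / 3 : ℝ) := hcP.integrable_of_hasCompactSupport hcptP
  refine ⟨iP, ?_⟩
  -- the `ℝ≥0∞` inequality and the identification of its three integrals
  have key := setLIntegral_betaTilde_rpow_le hψ hV ht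
  have hY := d.swirlEnergy_eq_ofReal hV ht4
  have hD := d.swirlDissipation_eq_ofReal hV ht4
  unfold swirlEnergy at hY
  unfold swirlDissipation at hD
  have heqP : ∀ x, ‖betaTilde ψ V t x‖ₑ ^ (10 / 3 : ℝ) =
      ENNReal.ofReal (betaTilde ψ V t x ^ (10 / 3 : ℝ)) := fun x => by
    rw [Real.enorm_eq_ofReal (hnn x), ENNReal.ofReal_rpow_of_nonneg (hnn x) (by norm_num)]
  have hP : ∫⁻ x in S₁, ‖betaTilde ψ V t x‖ₑ ^ (10 / 3 : ℝ) =
      ENNReal.ofReal (∫ x, betaTilde ψ V t x ^ (10 / 3 : ℝ)) := by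
    simp_rw [heqP]
    rw [setLIntegral_eq_of_support_subset]
    · exact (ofReal_integral_eq_lintegral_ofReal iP (Eventually.of_forall fun x =>
        Real.rpow_nonneg (hnn x) _)).symm
    · intro x hx
      by_contra h
      refine hx ?_
      show ENNReal.ofReal (betaTilde ψ V t x ^ (10 / 3 : ℝ)) = 0
      rw [d.betaTilde_eq_zero' V t fun h' => h (d.subset h'), Real.zero_rpow (by norm_num),
        ENNReal.ofReal_zero]
  rw [hP, hY, hD] at key
  set Y : ℝ := ∫ x, betaTilde ψ V t x ^ 2 with hYdef
  set Dr : ℝ := ∫ x, ‖fderiv ℝ (betaTilde ψ V t) x‖ ^ 2 with hDdef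
  set Pr : ℝ := ∫ x, betaTilde ψ V t x ^ (10 / 3 : ℝ) with hPdef
  have hY0 : 0 ≤ Y := integral_nonneg fun x => sq_nonneg _
  have hD0 : 0 ≤ Dr := integral_nonneg fun x => sq_nonneg _
  have hc0 : 0 ≤ (gnTenThirdsConst : ℝ) := NNReal.coe_nonneg _
  have key' : ENNReal.ofReal Pr ≤
      ENNReal.ofReal ((gnTenThirdsConst : ℝ) * (Y ^ (2 / 3 : ℝ) * Dr)) := by
    refine key.trans (le_of_eq ?_)
    rw [ENNReal.ofReal_mul hc0, ENNReal.ofReal_coe_nnreal, ENNReal.ofReal_mul (Real.rpow_nonneg hY0 _),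
      ENNReal.ofReal_rpow_of_nonneg hY0 (by norm_num)]
  have hreal : Pr ≤ (gnTenThirdsConst : ℝ) * (Y ^ (2 / 3 : ℝ) * Dr) :=
    (ENNReal.ofReal_le_ofReal_iff (by positivity)).1 key'
  have h23 := rpow_two_thirds_le Y hY0
  calc Pr ≤ (gnTenThirdsConst : ℝ) * (Y ^ (2 / 3 : ℝ) * Dr) := hreal
    _ ≤ (gnTenThirdsConst : ℝ) * ((1 + Y) * Dr) := by gcongr
    _ = (gnTenThirdsConst : ℝ) * (1 + Y) * Dr := by ring

omit d in
/-- **The energy of a slice on `𝒞̃₁`**, real form: `‖V(t, ·)‖²` is integrable on `𝒞̃₁` with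
`∫_{𝒞̃₁} ‖V‖² ≤ K`. [folklore] -/
theorem integrableOn_norm_sq_shellOne (hV : IsSmoothAxisymmetricSolutionOn Q V P) {t : ℝ}
    (ht : t ∈ Ioo (-(2 : ℝ) ^ 2) 0) {K : ℝ≥0}
    (hK : szEnergy V P (fun t x => fderiv ℝ (V t) x) ≤ K) :
    IntegrableOn (fun x => ‖V t x‖ ^ 2) S₁ ∧ ∫ x in S₁, ‖V t x‖ ^ 2 ≤ K := by
  obtain ⟨hi, hle⟩ := hV.integrableOn_norm_sq_slice ht hK
  refine ⟨hi.mono_set shell_one_subset_tilde, ?_⟩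
  exact (setIntegral_mono_set hi (Eventually.of_forall fun x => sq_nonneg _)
    (Eventually.of_forall shell_one_subset_tilde)).trans hle

omit d in
/-- **The gradient energy of a slice on `𝒞̃₁`**, real form (when `∫_𝒞̃ |∇V(t)|² < ∞`).
[folklore] -/
theorem integrableOn_frobeniusNormSq_shellOne (hV : IsSmoothAxisymmetricSolutionOn Q V P) {t : ℝ}
    (ht : t ∈ Ioo (-(2 : ℝ) ^ 2) 0) (hG : shellGradEnergy V t ≠ ⊤) :
    IntegrableOn (fun x => frobeniusNormSq (fderiv ℝ (V t) x)) S₁ ∧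
      ∫ x in S₁, frobeniusNormSq (fderiv ℝ (V t) x) ≤ (shellGradEnergy V t).toReal := by
  obtain ⟨hi, heq⟩ := hV.integrableOn_frobeniusNormSq_slice ht hG
  refine ⟨hi.mono_set shell_one_subset_tilde, ?_⟩
  rw [← heq]
  exact setIntegral_mono_set hi (Eventually.of_forall fun x => frobeniusNormSq_nonneg _)
    (Eventually.of_forall shell_one_subset_tilde)

omit d in
/-- **Lemma 4.2 at `q = 20`, real form**: `|V^a(t, ·)|²⁰` is integrable on `𝒞̃₁` with
`∫_{𝒞̃₁} |V^a|²⁰ ≤ Φ₁(20, K)`. [cite: SereginZajaczkowski2007, Lemma 4.2 ((4.2), q = 20)] -/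
theorem integrableOn_poloidalSpeed_pow_shellOne (hV : IsSmoothAxisymmetricSolutionOn Q V P)
    {K : ℝ≥0} (hK : szEnergy V P (fun t x => fderiv ℝ (V t) x) ≤ K) {t : ℝ}
    (ht : t ∈ Ioo (-(7 / 4 : ℝ) ^ 2) 0) :
    IntegrableOn (fun x => poloidalSpeed (V t) x ^ 20) S₁ ∧
      ∫ x in S₁, poloidalSpeed (V t) x ^ 20 ≤ (poloidalPhi 20 K : ℝ) := by
  have ht4 := mem_Ioo_four_of_mem ht
  have hlin := setLIntegral_poloidalSpeed_twenty_le hV hK ht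
  have hps0 : ∀ x, 0 ≤ poloidalSpeed (V t) x := fun x => poloidalSpeed_nonneg _ _
  have heq : ∀ x, ENNReal.ofReal (poloidalSpeed (V t) x ^ 20) =
      ‖poloidalSpeed (V t) x‖ₑ ^ ((20 : ℝ≥0) : ℝ) := fun x => by
    rw [Real.enorm_eq_ofReal (hps0 x), show ((20 : ℝ≥0) : ℝ) = ((20 : ℕ) : ℝ) by norm_num,
      ENNReal.rpow_natCast, ENNReal.ofReal_pow (hps0 x)]
  have hcont : ContinuousOn (fun x => poloidalSpeed (V t) x ^ 20) S₁ :=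
    ((continuousOn_poloidalSpeed (hV.continuousOn_slice ht4)).mono shell_one_subset_tilde).pow 20
  have hm : AEStronglyMeasurable (fun x => poloidalSpeed (V t) x ^ 20) (volume.restrict S₁) :=
    hcont.aestronglyMeasurable (isOpen_shell _ _ _).measurableSet
  have hfin : HasFiniteIntegral (fun x => poloidalSpeed (V t) x ^ 20) (volume.restrict S₁) := by
    rw [hasFiniteIntegral_iff_ofReal (Eventually.of_forall fun x => pow_nonneg (hps0 x) 20)]
    simp_rw [heq]
    exact lt_of_le_of_lt hlin ENNReal.coe_lt_top
  refine ⟨⟨hm, hfin⟩, ?_⟩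
  rw [integral_eq_lintegral_of_nonneg_ae (Eventually.of_forall fun x => pow_nonneg (hps0 x) 20) hm]
  simp_rw [heq]
  have h := ENNReal.toReal_mono ENNReal.coe_ne_top hlin
  rwa [ENNReal.coe_toReal] at h

/-- **The `J₁`-integral**: for every `l > 0`,
`∫ |α̃|³|α||V^a| ≤ (9l/2) ∫_{𝒞̃₁}‖V‖² + (∫ β̃^{10/3} + ∫_{𝒞̃₁}|V^a|²⁰)/(2l)`.
[cite: SereginZajaczkowski2007, proof of Lemma 4.3 (estimate of J₁ by Hölder, (4.17) and Lemma 4.2)] -/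
theorem integral_J₁_le (hψ : IsSwirlCutoff ψ) (hV : IsSmoothAxisymmetricSolutionOn Q V P)
    {K : ℝ≥0} (hK : szEnergy V P (fun t x => fderiv ℝ (V t) x) ≤ K) {t : ℝ}
    (ht : t ∈ Ioo (-(7 / 4 : ℝ) ^ 2) 0) {l : ℝ} (hl : 0 < l) :
    ∫ x, |alphaTilde ψ V t x| ^ 3 * (|swirl (V t) x| * poloidalSpeed (V t) x) ≤
      9 * l / 2 * (∫ x in S₁, ‖V t x‖ ^ 2) +
        ((∫ x, betaTilde ψ V t x ^ (10 / 3 : ℝ)) + ∫ x in S₁, poloidalSpeed (V t) x ^ 20) / (2 * l) := by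
  have ht4 := mem_Ioo_four_of_mem ht
  have hsw : ContinuousOn (fun x => swirl (V t) x) 𝒞 :=
    continuousOn_slice_of_continuousOn hV.continuousOn_swirl ht4
  have hg₁ : ContinuousOn (fun x => |swirl (V t) x| * poloidalSpeed (V t) x) 𝒞 :=
    hsw.abs.mul (continuousOn_poloidalSpeed (hV.continuousOn_slice ht4))
  have i1 := d.integrable_abs_pow_three_mul hV ht4 hg₁
  obtain ⟨iA, -⟩ := integrableOn_norm_sq_shellOne hV ht4 hK
  obtain ⟨iP, -⟩ := d.integral_betaTilde_rpow_le hψ hV ht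
  obtain ⟨iQ, -⟩ := integrableOn_poloidalSpeed_pow_shellOne hV hK ht
  have hPset : ∫ x in S₁, betaTilde ψ V t x ^ (10 / 3 : ℝ) = ∫ x, betaTilde ψ V t x ^ (10 / 3 : ℝ) :=
    setIntegral_eq_integral_of_forall_compl_eq_zero fun x hx => by
      rw [d.betaTilde_eq_zero' V t fun h => hx (d.subset h), Real.zero_rpow (by norm_num)]
  have iPQ : IntegrableOn (fun x => betaTilde ψ V t x ^ (10 / 3 : ℝ) + poloidalSpeed (V t) x ^ 20) S₁ :=
    iP.integrableOn.add iQ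
  have iA' : IntegrableOn (fun x => 9 * l / 2 * ‖V t x‖ ^ 2) S₁ := iA.const_mul _
  have iPQ' : IntegrableOn (fun x =>
      (betaTilde ψ V t x ^ (10 / 3 : ℝ) + poloidalSpeed (V t) x ^ 20) / (2 * l)) S₁ :=
    iPQ.div_const _
  have hg : IntegrableOn (fun x => 9 * l / 2 * ‖V t x‖ ^ 2 +
      (betaTilde ψ V t x ^ (10 / 3 : ℝ) + poloidalSpeed (V t) x ^ 20) / (2 * l)) S₁ :=
    iA'.add iPQ'
  have hzero : ∀ x ∉ S₁, |alphaTilde ψ V t x| ^ 3 * (|swirl (V t) x| * poloidalSpeed (V t) x) = 0 := by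
    intro x hx
    rw [d.alphaTilde_eq_zero_of_notMem_shellOne V t hx]
    simp
  have hle : ∀ x ∈ S₁, |alphaTilde ψ V t x| ^ 3 * (|swirl (V t) x| * poloidalSpeed (V t) x) ≤
      9 * l / 2 * ‖V t x‖ ^ 2 +
        (betaTilde ψ V t x ^ (10 / 3 : ℝ) + poloidalSpeed (V t) x ^ 20) / (2 * l) := by
    intro x hx
    have h := young_J₁ (u := V t) (shell_one_subset_tilde hx) (alphaTilde ψ V t x)
      (poloidalSpeed (V t) x) hl
    have hb : betaTilde ψ V t x = alphaTilde ψ V t x ^ 2 := rfl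
    rw [hb]
    exact h
  have hbound := integral_le_setIntegral_shellOne i1 hzero hg hle
  have e1 : ∫ x in S₁, (9 * l / 2 * ‖V t x‖ ^ 2 +
      (betaTilde ψ V t x ^ (10 / 3 : ℝ) + poloidalSpeed (V t) x ^ 20) / (2 * l)) =
      (∫ x in S₁, 9 * l / 2 * ‖V t x‖ ^ 2) +
        ∫ x in S₁, (betaTilde ψ V t x ^ (10 / 3 : ℝ) + poloidalSpeed (V t) x ^ 20) / (2 * l) :=
    integral_add iA' iPQ'
  have e2 : ∫ x in S₁, 9 * l / 2 * ‖V t x‖ ^ 2 = 9 * l / 2 * ∫ x in S₁, ‖V t x‖ ^ 2 :=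
    integral_const_mul _ _
  have e3 : ∫ x in S₁, (betaTilde ψ V t x ^ (10 / 3 : ℝ) + poloidalSpeed (V t) x ^ 20) / (2 * l) =
      ((∫ x, betaTilde ψ V t x ^ (10 / 3 : ℝ)) + ∫ x in S₁, poloidalSpeed (V t) x ^ 20) / (2 * l) := by
    rw [integral_div, integral_add iP.integrableOn iQ, hPset]
  rw [e1, e2, e3] at hbound
  exact hbound

/-- **The `J₂`-integral**: for every `m > 0` (and `∫_𝒞̃|∇V(t)|² < ∞`),
`∫ |α̃|³(|α| + ‖∇α‖) ≤ m(11∫_{𝒞̃₁}‖V‖² + 18∫_{𝒞̃₁}|∇V|²) + (∫β̃² + ∫β̃^{10/3})/(2m)`.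
[cite: SereginZajaczkowski2007, proof of Lemma 4.3 (estimate of J₂ by Hölder and (4.17))] -/
theorem integral_J₂_le (hψ : IsSwirlCutoff ψ) (hV : IsSmoothAxisymmetricSolutionOn Q V P)
    {K : ℝ≥0} (hK : szEnergy V P (fun t x => fderiv ℝ (V t) x) ≤ K) {t : ℝ}
    (ht : t ∈ Ioo (-(7 / 4 : ℝ) ^ 2) 0) (hG : shellGradEnergy V t ≠ ⊤) {m : ℝ} (hm : 0 < m) :
    ∫ x, |alphaTilde ψ V t x| ^ 3 * (|swirl (V t) x| + ‖fderiv ℝ (swirl (V t)) x‖) ≤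
      m * (11 * (∫ x in S₁, ‖V t x‖ ^ 2) + 18 * ∫ x in S₁, frobeniusNormSq (fderiv ℝ (V t) x)) +
        ((∫ x, betaTilde ψ V t x ^ 2) + ∫ x, betaTilde ψ V t x ^ (10 / 3 : ℝ)) / (2 * m) := by
  have ht4 := mem_Ioo_four_of_mem ht
  have hsw : ContinuousOn (fun x => swirl (V t) x) 𝒞 :=
    continuousOn_slice_of_continuousOn hV.continuousOn_swirl ht4
  have hg₂ : ContinuousOn (fun x => |swirl (V t) x| + ‖fderiv ℝ (swirl (V t)) x‖) 𝒞 :=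
    hsw.abs.add (continuousOn_fderiv_swirl_slice hV ht4).norm
  have i2 := d.integrable_abs_pow_three_mul hV ht4 hg₂
  obtain ⟨iA, -⟩ := integrableOn_norm_sq_shellOne hV ht4 hK
  obtain ⟨iG, -⟩ := integrableOn_frobeniusNormSq_shellOne hV ht4 hG
  obtain ⟨iP, -⟩ := d.integral_betaTilde_rpow_le hψ hV ht
  have hc : Continuous (betaTilde ψ V t) := d.continuous_betaTilde hV ht4
  have hcptY : HasCompactSupport fun x => betaTilde ψ V t x ^ 2 :=
    (d.hasCompactSupport_betaTilde' V t).comp_left (g := fun r : ℝ => r ^ 2) (by simp)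
  have iY : Integrable fun x => betaTilde ψ V t x ^ 2 := (hc.pow 2).integrable_of_hasCompactSupport hcptY
  have hPset : ∫ x in S₁, betaTilde ψ V t x ^ (10 / 3 : ℝ) = ∫ x, betaTilde ψ V t x ^ (10 / 3 : ℝ) :=
    setIntegral_eq_integral_of_forall_compl_eq_zero fun x hx => by
      rw [d.betaTilde_eq_zero' V t fun h => hx (d.subset h), Real.zero_rpow (by norm_num)]
  have hYset : ∫ x in S₁, betaTilde ψ V t x ^ 2 = ∫ x, betaTilde ψ V t x ^ 2 :=
    setIntegral_eq_integral_of_forall_compl_eq_zero fun x hx => by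
      rw [d.betaTilde_eq_zero' V t fun h => hx (d.subset h), zero_pow two_ne_zero]
  have iA11 : IntegrableOn (fun x => 11 * ‖V t x‖ ^ 2) S₁ := iA.const_mul _
  have iG18 : IntegrableOn (fun x => 18 * frobeniusNormSq (fderiv ℝ (V t) x)) S₁ := iG.const_mul _
  have iAG : IntegrableOn (fun x => 11 * ‖V t x‖ ^ 2 + 18 * frobeniusNormSq (fderiv ℝ (V t) x)) S₁ :=
    iA11.add iG18
  have iAG' : IntegrableOn (fun x =>
      m * (11 * ‖V t x‖ ^ 2 + 18 * frobeniusNormSq (fderiv ℝ (V t) x))) S₁ := iAG.const_mul _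
  have iYP : IntegrableOn (fun x => betaTilde ψ V t x ^ 2 + betaTilde ψ V t x ^ (10 / 3 : ℝ)) S₁ :=
    iY.integrableOn.add iP.integrableOn
  have iYP' : IntegrableOn (fun x =>
      (betaTilde ψ V t x ^ 2 + betaTilde ψ V t x ^ (10 / 3 : ℝ)) / (2 * m)) S₁ := iYP.div_const _
  have hg : IntegrableOn (fun x => m * (11 * ‖V t x‖ ^ 2 + 18 * frobeniusNormSq (fderiv ℝ (V t) x)) +
      (betaTilde ψ V t x ^ 2 + betaTilde ψ V t x ^ (10 / 3 : ℝ)) / (2 * m)) S₁ :=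
    iAG'.add iYP'
  have hzero : ∀ x ∉ S₁,
      |alphaTilde ψ V t x| ^ 3 * (|swirl (V t) x| + ‖fderiv ℝ (swirl (V t)) x‖) = 0 := by
    intro x hx
    rw [d.alphaTilde_eq_zero_of_notMem_shellOne V t hx]
    simp
  have hle : ∀ x ∈ S₁, |alphaTilde ψ V t x| ^ 3 * (|swirl (V t) x| + ‖fderiv ℝ (swirl (V t)) x‖) ≤
      m * (11 * ‖V t x‖ ^ 2 + 18 * frobeniusNormSq (fderiv ℝ (V t) x)) +
        (betaTilde ψ V t x ^ 2 + betaTilde ψ V t x ^ (10 / 3 : ℝ)) / (2 * m) := by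
    intro x hx
    have h := young_J₂ (hV.differentiableAt_slice ht4 (shell_one_subset_tilde hx))
      (shell_one_subset_tilde hx) (alphaTilde ψ V t x) hm
    have hb : betaTilde ψ V t x = alphaTilde ψ V t x ^ 2 := rfl
    rw [hb]
    exact h
  have hbound := integral_le_setIntegral_shellOne i2 hzero hg hle
  have e1 : ∫ x in S₁, (m * (11 * ‖V t x‖ ^ 2 + 18 * frobeniusNormSq (fderiv ℝ (V t) x)) +
      (betaTilde ψ V t x ^ 2 + betaTilde ψ V t x ^ (10 / 3 : ℝ)) / (2 * m)) =
      (∫ x in S₁, m * (11 * ‖V t x‖ ^ 2 + 18 * frobeniusNormSq (fderiv ℝ (V t) x))) +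
        ∫ x in S₁, (betaTilde ψ V t x ^ 2 + betaTilde ψ V t x ^ (10 / 3 : ℝ)) / (2 * m) :=
    integral_add iAG' iYP'
  have e2 : ∫ x in S₁, m * (11 * ‖V t x‖ ^ 2 + 18 * frobeniusNormSq (fderiv ℝ (V t) x)) =
      m * (11 * (∫ x in S₁, ‖V t x‖ ^ 2) + 18 * ∫ x in S₁, frobeniusNormSq (fderiv ℝ (V t) x)) := by
    rw [integral_const_mul, integral_add iA11 iG18, integral_const_mul, integral_const_mul]
  have e3 : ∫ x in S₁, (betaTilde ψ V t x ^ 2 + betaTilde ψ V t x ^ (10 / 3 : ℝ)) / (2 * m) =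
      ((∫ x, betaTilde ψ V t x ^ 2) + ∫ x, betaTilde ψ V t x ^ (10 / 3 : ℝ)) / (2 * m) := by
    rw [integral_div, integral_add iY.integrableOn iP.integrableOn, hPset, hYset]
  rw [e1, e2, e3] at hbound
  exact hbound


/-! ### The fixed-time `L⁴`-energy inequality in kernel form -/

omit d in
/-- `1 ≤ A(K)`. [folklore] -/
theorem one_le_l4KernelConst (M : ℝ) (K : ℝ≥0) : 1 ≤ l4KernelConst M K := by
  unfold l4KernelConst
  have h : (1 : ℝ≥0) ≤ 1 + poloidalPhi 20 K := le_self_add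
  exact h.trans le_self_add

omit d in
/-- The real value of `A(K)` for nonnegative `M`. [folklore] -/
theorem coe_l4KernelConst {M : ℝ} (hM : 0 ≤ M) (K : ℝ≥0) :
    ((l4KernelConst M K : ℝ≥0) : ℝ) =
      1 + (poloidalPhi 20 K : ℝ) + 12000 * (M + 1) ^ 2 * ((gnTenThirdsConst : ℝ) + 1) * (1 + K) := by
  unfold l4KernelConst
  push_cast
  rw [Real.coe_toNNReal _ hM]

/-- **Seregin–Zajaczkowski 2007, proof of Lemma 4.3: the main differential inequality at a fixed
time, kernel form.** For the class of Prop. 4.1 with `𝒜₂ ≤ K`, a cut-off of the printed kind with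
data `(C, t₀, M)`, and `-(7/4)² < t < 0`:
`ofReal (∫ ∂ₜ(α̃⁴) dx + ∫ ‖∇ₓβ̃‖² dx) ≤ A(K) (1 + ∫_𝒞̃ |∇V(·,t)|² dx)(1 + ∫ β̃²)` in `ℝ≥0∞`
(trivial when the gradient energy of the slice is infinite; otherwise (4.16), the remainder bound,
the Young estimates of `J₁`, `J₂`, (4.17) and Lemma 4.2 at `q = 20`, combined by `l4_energy_arith`).
This is the printed "main inequality" `∂ₜ∫|α̃|⁴ + ∫|∇_a(|α̃|²)|² ≤ c∫|β̃|²(∫|∇V|² + 𝒜₂) + …`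
with all constants made explicit and monotone in `K`.
[cite: SereginZajaczkowski2007, proof of Lemma 4.3 (the main inequality before (4.18))] -/
theorem ofReal_integral_l4Density_add_le (hψ : IsSwirlCutoff ψ)
    (hV : IsSmoothAxisymmetricSolutionOn Q V P) {K : ℝ≥0}
    (hK : szEnergy V P (fun t x => fderiv ℝ (V t) x) ≤ K) {t : ℝ}
    (ht : t ∈ Ioo (-(7 / 4 : ℝ) ^ 2) 0) :
    ENNReal.ofReal ((∫ x, l4Density ψ V t x) + ∫ x, ‖fderiv ℝ (betaTilde ψ V t) x‖ ^ 2) ≤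
      (l4KernelConst M K : ℝ≥0∞) * (1 + shellGradEnergy V t) * (1 + swirlEnergy ψ V t) := by
  have ht4 := mem_Ioo_four_of_mem ht
  by_cases hG : shellGradEnergy V t = ⊤
  · rw [hG, add_top]
    have h1 : (l4KernelConst M K : ℝ≥0∞) ≠ 0 := by
      have h := one_le_l4KernelConst M K
      exact_mod_cast (lt_of_lt_of_le zero_lt_one h).ne'
    have h2 : (1 + swirlEnergy ψ V t) ≠ 0 := (lt_of_lt_of_le zero_lt_one le_self_add).ne'
    rw [ENNReal.mul_top h1, ENNReal.top_mul h2]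
    exact le_top
  -- the real inequality
  have hB := d.integral_l4Density_add_dissipation_le hV ht4
  have hR := d.integral_pow_three_mul_l4Remainder_le hV ht4
  have hT₁nn : 0 ≤ ∫ x, |alphaTilde ψ V t x| ^ 3 * (|swirl (V t) x| * poloidalSpeed (V t) x) :=
    integral_nonneg fun x => by positivity [poloidalSpeed_nonneg (V t) x]
  have hT₂nn : 0 ≤ ∫ x, |alphaTilde ψ V t x| ^ 3 * (|swirl (V t) x| + ‖fderiv ℝ (swirl (V t)) x‖) :=
    integral_nonneg fun x => by positivity
  have hM := d.M_nonneg
  have hI : (∫ x, l4Density ψ V t x) + 3 * (∫ x, ‖fderiv ℝ (betaTilde ψ V t) x‖ ^ 2) ≤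
      36 * (M + 1) * (∫ x, |alphaTilde ψ V t x| ^ 3 * (|swirl (V t) x| + ‖fderiv ℝ (swirl (V t)) x‖)) +
        4 * (M + 1) * ∫ x, |alphaTilde ψ V t x| ^ 3 * (|swirl (V t) x| * poloidalSpeed (V t) x) := by
    nlinarith [mul_nonneg hM hT₁nn, mul_nonneg hM hT₂nn]
  have hT₁ := fun (l : ℝ) (hl : 0 < l) => d.integral_J₁_le hψ hV hK ht hl
  have hT₂ := fun (m : ℝ) (hm : 0 < m) => d.integral_J₂_le hψ hV hK ht hG hm
  obtain ⟨-, hP⟩ := d.integral_betaTilde_rpow_le hψ hV ht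
  obtain ⟨-, hA⟩ := integrableOn_norm_sq_shellOne hV ht4 hK
  obtain ⟨-, hGle⟩ := integrableOn_frobeniusNormSq_shellOne hV ht4 hG
  obtain ⟨-, hQ⟩ := integrableOn_poloidalSpeed_pow_shellOne hV hK ht
  have hY0 : 0 ≤ ∫ x, betaTilde ψ V t x ^ 2 := integral_nonneg fun x => sq_nonneg _
  have hD0 : 0 ≤ ∫ x, ‖fderiv ℝ (betaTilde ψ V t) x‖ ^ 2 := integral_nonneg fun x => sq_nonneg _
  have hA0 : 0 ≤ ∫ x in S₁, ‖V t x‖ ^ 2 := integral_nonneg fun x => sq_nonneg _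
  have hG0 : 0 ≤ ∫ x in S₁, frobeniusNormSq (fderiv ℝ (V t) x) :=
    integral_nonneg fun x => frobeniusNormSq_nonneg _
  have hQ0 : 0 ≤ ∫ x in S₁, poloidalSpeed (V t) x ^ 20 :=
    integral_nonneg fun x => pow_nonneg (poloidalSpeed_nonneg _ _) 20
  have hc0 : 0 ≤ (gnTenThirdsConst : ℝ) := NNReal.coe_nonneg _
  have key := l4_energy_arith hM hc0 hY0 hD0 hA0 hG0 hQ0 hA hGle hQ hP hI hT₁ hT₂
  -- conversion to `ℝ≥0∞`
  have hGr : 0 ≤ (shellGradEnergy V t).toReal := ENNReal.toReal_nonneg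
  have hAr : 0 ≤ 1 + (poloidalPhi 20 K : ℝ) + 12000 * (M + 1) ^ 2 * ((gnTenThirdsConst : ℝ) + 1) * (1 + K) := by
    positivity
  calc ENNReal.ofReal ((∫ x, l4Density ψ V t x) + ∫ x, ‖fderiv ℝ (betaTilde ψ V t) x‖ ^ 2)
      ≤ ENNReal.ofReal ((1 + (poloidalPhi 20 K : ℝ) +
          12000 * (M + 1) ^ 2 * ((gnTenThirdsConst : ℝ) + 1) * (1 + K)) *
          (1 + (shellGradEnergy V t).toReal) * (1 + ∫ x, betaTilde ψ V t x ^ 2)) :=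
        ENNReal.ofReal_le_ofReal key
    _ = (l4KernelConst M K : ℝ≥0∞) * (1 + shellGradEnergy V t) * (1 + swirlEnergy ψ V t) := by
        rw [ENNReal.ofReal_mul (by positivity), ENNReal.ofReal_mul hAr, ← coe_l4KernelConst hM K,
          ENNReal.ofReal_coe_nnreal, ENNReal.ofReal_add zero_le_one hGr, ENNReal.ofReal_one,
          ENNReal.ofReal_toReal hG, ENNReal.ofReal_add zero_le_one hY0, ENNReal.ofReal_one,
          ← d.swirlEnergy_eq_ofReal hV ht4]

end SwirlCutoffData

end FixedTime

end SereginZajaczkowski2007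

end Literature.Analysis.FluidPDE
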